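import Summits.QuantumFields.YangMills.Theorems.BalabanUVNodesN11TStepOldBranchInnerSum

/-!
# DAG node N11 — (O3′) FROM THE OLD-BRANCH DATA WITH THE INNER READINGS SUPPLIED BY A FIBRE-CHART SOCKET OF THE INSIDE STEP: `hin₀` DISCHARGED, `Fᵢ₀` EXPLICIT
# (the chart's fibre integral of each old-branch piece), the per-old-branch charted identification stated ON THE CHART

HEADER — WORK-UNIT METADATA.  Cell `pub-ymgap`, YM-PLAN Track A (HUMAN RULING D-0062), seat `pub-ymgap-dag-n11-d` (g15; R134 fan-out base seat N11 [B14], strategy s2),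
route `BalabanUVNodes` rev 27, item K1⁸ `StabilityBRunRowsAtRecordR13SepCoPH` = stmt-QuantumFields-26907 (helper lane, `--kind proof --supports 26907 --as helper`,
count-neutral).  [I] = [Balaban1987RG1], [III] = [Balaban1988Convergent].  Sequel of this seat's `…N11TStepOldBranchInnerSum` (p623644: ★★★★★★
`slotsTOfRecord_succ_ae_eq_TkOfRecord_succ_of_oldBranchInnerSum` — (O3′) on the nose from the level-`k` form + per-old-branch `hG₀` ∕ `hin₀` ∕ `hinner₀` + `hint`) and of this seat's
g14 SOCKET `…N11KernelTransportInFibreChart` (p610288: ★★★ `kernelTransport_ae_eq_integral_chart_of_support` — a fibre chart `(X, κ, Ψ, J, S; hpush, hfib)` of an averaging makes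
def-T's `kernelTransport` of every integrable density supported in `S` a.e. EQUAL TO THE CHART's FIBRE INTEGRAL `V ↦ ∫ J(V,x)·ρ(Ψ(V,x)) κ_V(dx)`), over dag-n11-e's presentation of
record (`measurable_avOfRecord_glue_skew`, `map_prod_avOfRecord_glue_skew_absolutelyContinuous_Omega`, `measurePreserving_piEquivPiSubtypeProd_symm_fieldMeasure`).

WHY THIS FILE.  In p623644 the per-old-branch inner readings `Fᵢ₀ S₀` and their laws `hin₀` are ABSTRACT.  A fibre-chart SOCKET of the INSIDE step — the skew averaging
`q ↦ (q.1, Ū(e_β q)|_{sV'ᶜ})` from the fine product carrier `Π_{sV} Haar ⊗ Π_{sVᶜ} Haar` to the mixed one `Π_{sV} Haar ⊗ Π_{sV'ᶜ} Haar` (the step p616225's `hin` transports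
along) — with data `(κ, Ψ, J, S; hΨ, hJ, hpush, hfib)` SUPPLIES them for every piece at once: `Fᵢ₀ S₀ z := ∫ J(z,x)·(G_{S₀} ∘ e_β)(Ψ(z,x)) κ_z(dx)` (p610288 ★★★), GIVEN that the
pieces are measurable and vanish off the charted set `S` — which they do as soon as the step weight's graph section does (`hwS`: in (3.2)–(3.5) the new small-field
characteristic functions force the charted windows).  dag-n11-w6 g2's CLAIM-3 `…N11InnerTransportInPrivateCoordinateChart` INHABITS exactly this socket at the record by per-bond
inversions of the (0.4) fibre maps OFF `sV′` (private coordinates = central bonds); any other chart (the Lie–Haar ∕ (47) road) plugs in the same way.  After this file the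
(O3′) road displays, besides Theorem 1's level-`k` form and the integrability ∕ measurability rows, ONE hypothesis with mathematical content: THE PER-OLD-BRANCH CHARTED
IDENTIFICATION ON THE CHART `hinner₀` — for a.e. presented coarse point `q` and every inside fine `y` on the averaging fibre,
`∫ J((y,q.2),x)·G_{S₀}(e_β(Ψ((y,q.2),x))) κ(dx) = Σ_Y ζ_k(ω_y)·(aOp k sA w_{S₀,Y} (𝐓_k(init s′,S₀)[W] Φ_{S₀ ∪ Y}))(ω_y)` — [I] §2's change of variables on the outside fibre with its
Jacobian, the gauge fixing, `ζ`, AND [III] Thm 2's re-expansion of the new small-field integral; DISPLAYED, not proved.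

WHAT THIS FILE PROVES (0 `def`, 0 `sorry`, standard axioms).  `oldBranch_piece_comp_glue_eq_zero_of_weight` (support of the pieces from the weight's) ·
`measurable_oldBranch_piece_comp_glue` · ★ `innerReading_of_oldBranch_piece_of_innerChart` (`hin₀` for ONE piece from the socket, p610288 ★★★ at the inside step) ·
★★★★★★ `slotsTOfRecord_succ_ae_eq_TkOfRecord_succ_of_oldBranchInnerChart` ((O3′)'s identity on the nose from: the level-`k` form, `hG₀`, the SOCKET, `hwS`, measurability of
the pieces' factors, `hint`, and `hinner₀` ON THE CHART).

HONEST FRAMING.  Helper lane of K1⁸; count-neutral; compositions BY NAME; the socket data `(κ, Ψ, J, S; hpush, hfib)` are HYPOTHESES (dag-n11-w6 g2's file inhabits them modulo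
per-bond inversion data); `hinner₀` DISPLAYED; NO chart of Bałaban's asserted, NO Jacobian evaluated, NO Gaussian integration, nothing of [I] §2 ∕ [III] §3 ∕ Thm 2 asserted; (B4) ∕
(S-α) ∕ (O3′) NOT closed; N11 NOT discharged; K1⁸ NOT closed, no registered stub touched; counts unmoved (typed 28∕28 · discharged 5∕27 · A 5∕28).  One finite `𝕋⁴_{L^K}` programme
at fixed `ε = L^{−K}`; R4 closes only the conditional finite-𝕋⁴ rung `BalabanLadder.UV` — NOT ℝ⁴, NOT OS, NOT a mass gap, NOT Clay.  No `sorry`, `axiom`, `def`, `instance`, `notation`.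
Sources (SHAPE ∕ bookkeeping only): [I] (0.4) p.253, §2 p.267; [III] (2.18) p.257, (2.20)–(2.21) p.258, (3.1) p.264, (3.2)–(3.5) p.265, (3.24)–(3.25) p.270, §3 p.279.
-/

noncomputable section

open MeasureTheory ProbabilityTheory
open scoped ENNReal NNReal BigOperators

namespace Summit.QuantumFields.YangMills.Theorems.BalabanUVNodesN11TStepOldBranchInnerChart

open Literature.MathematicalPhysics.QuantumFieldTheory.Balaban1983to89
open Literature.MathematicalPhysics.QuantumFieldTheory.Balaban1983to89.T4AveragingDisintegration
open BalabanUVNodesN11TStepOldBranchInnerSum (slotsTOfRecord_succ_ae_eq_TkOfRecord_succ_of_oldBranchInnerSum)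
open BalabanUVNodesN11KernelTransportInFibreChart (kernelTransport_ae_eq_integral_chart_of_support)
open BalabanUVNodesN11AveragingSkewPresentationAtRecord (map_prod_avOfRecord_glue_skew_absolutelyContinuous_Omega)
open BalabanUVNodesN11TkOpMeasurable (measurable_tkBranchOfRecord_baseCfg)
open Node00 hiding SU
open Node00.Tk T4Continuum B14.Eq218Concrete
open B10Eq42TorusConstraint (bondsIn)

variable {F : T4Family} {N : ℕ} [NeZero N]
variable {V : Type} [NormedAddCommGroup V] [InnerProductSpace ℝ V] [FiniteDimensional ℝ V] [MeasurableSpace V] [BorelSpace V]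

/-- **THE OLD-BRANCH PIECES VANISH WHERE THE STEP WEIGHT's GRAPH SECTION DOES** (they carry it as a factor): a support clause for `w(s′)(·,Ū)` through the glue is one for every
piece. [cite: Balaban1988Convergent, (3.2)–(3.5) p.265 (bookkeeping)] -/
theorem oldBranch_piece_comp_glue_eq_zero_of_weight (ν : Stage7Numerics) (τ : TowerNumerics) (w : StepWeightsOfRecord F N ν τ.M) (p : B12.RunParams) (g : ℕ → ℝ)
    {k : ℕ} [DecidableEq (PBond (F.P p.K) k)] (s' : SeqOfRecord F ν τ.M g p.K (k + 1)) (W₀ : TkWeights F N V p.K)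
    (Φ₀ : SFluct (F.P p.K) V → B15DeterminingSets.MSField (F.P p.K) (SU N) → ℝ) (S₀ : ℕ → Set (Site (F.P p.K) 0))
    {S : Set ((↥(Set.toFinite (bondsIn k (s'.Ω (k + 1))ᶜ)).toFinset → SU N) × ({b : PBond (F.P p.K) k // b ∉ (Set.toFinite (bondsIn k (s'.Ω (k + 1))ᶜ)).toFinset} → SU N))}
    (hwS : ∀ q : (↥(Set.toFinite (bondsIn k (s'.Ω (k + 1))ᶜ)).toFinset → SU N) × ({b : PBond (F.P p.K) k // b ∉ (Set.toFinite (bondsIn k (s'.Ω (k + 1))ᶜ)).toFinset} → SU N), q ∉ S →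
      w p g k s' (⇑(MeasurableEquiv.piEquivPiSubtypeProd (fun _ : PBond (F.P p.K) k => SU N)
            (· ∈ (Set.toFinite (bondsIn k (s'.Ω (k + 1))ᶜ)).toFinset)).symm q) ((avOfRecord F N p.K k).avg (⇑(MeasurableEquiv.piEquivPiSubtypeProd (fun _ : PBond (F.P p.K) k => SU N)
            (· ∈ (Set.toFinite (bondsIn k (s'.Ω (k + 1))ᶜ)).toFinset)).symm q)) = 0)
    (q : (↥(Set.toFinite (bondsIn k (s'.Ω (k + 1))ᶜ)).toFinset → SU N) × ({b : PBond (F.P p.K) k // b ∉ (Set.toFinite (bondsIn k (s'.Ω (k + 1))ᶜ)).toFinset} → SU N)) (hq : q ∉ S) :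
    ((fun U => w p g k s' U ((avOfRecord F N p.K k).avg U) *
        (chiSeqOfRecord F N ν τ.M g p.K k s'.init U *
          tkBranchOfRecord F N V ν τ.M g p.K W₀ s'.init S₀ k (fun ω => Φ₀ (S₀, fun j => (ω j).2) (fun j => (ω j).1)) (baseCfg k U))) ∘
      ⇑(MeasurableEquiv.piEquivPiSubtypeProd (fun _ : PBond (F.P p.K) k => SU N)
            (· ∈ (Set.toFinite (bondsIn k (s'.Ω (k + 1))ᶜ)).toFinset)).symm) q = 0 := by
  rw [Function.comp_apply, hwS q hq, zero_mul]

/-- **THE OLD-BRANCH PIECES READ THROUGH THE GLUE ARE MEASURABLE** when the step weight's graph section, `χ_k(init s′)`, the old weights' `ζ_j(Y)` ∕ `w_j(Λ′,Y,S)` and the old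
operand at the branch are (this seat's g10 `measurable_tkBranchOfRecord_baseCfg`; the glue is a measurable equivalence). [cite: Balaban1988Convergent, (2.18) p.257, (2.20)–(2.21) p.258 (bookkeeping)] -/
theorem measurable_oldBranch_piece_comp_glue (ν : Stage7Numerics) (τ : TowerNumerics) (w : StepWeightsOfRecord F N ν τ.M) (p : B12.RunParams) (g : ℕ → ℝ)
    {k : ℕ} [DecidableEq (PBond (F.P p.K) k)] (s' : SeqOfRecord F ν τ.M g p.K (k + 1)) (W₀ : TkWeights F N V p.K)
    (Φ₀ : SFluct (F.P p.K) V → B15DeterminingSets.MSField (F.P p.K) (SU N) → ℝ) (S₀ : ℕ → Set (Site (F.P p.K) 0))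
    (hwm : Measurable fun U => w p g k s' U ((avOfRecord F N p.K k).avg U)) (hχm : Measurable (chiSeqOfRecord F N ν τ.M g p.K k s'.init))
    (hζm : ∀ j Y, Measurable (W₀.ζ j Y)) (hwWm : ∀ j Λ' Y S, Measurable (W₀.w j Λ' Y S))
    (hΦ₀m : Measurable fun ω : MultiCfg (F.P p.K) (SU N) V => Φ₀ (S₀, fun j => (ω j).2) (fun j => (ω j).1)) :
    Measurable ((fun U => w p g k s' U ((avOfRecord F N p.K k).avg U) *
        (chiSeqOfRecord F N ν τ.M g p.K k s'.init U *
          tkBranchOfRecord F N V ν τ.M g p.K W₀ s'.init S₀ k (fun ω => Φ₀ (S₀, fun j => (ω j).2) (fun j => (ω j).1)) (baseCfg k U))) ∘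
      ⇑(MeasurableEquiv.piEquivPiSubtypeProd (fun _ : PBond (F.P p.K) k => SU N)
            (· ∈ (Set.toFinite (bondsIn k (s'.Ω (k + 1))ᶜ)).toFinset)).symm) :=
  (hwm.mul (hχm.mul (measurable_tkBranchOfRecord_baseCfg F N V ν τ.M g p.K W₀ hζm hwWm s'.init S₀ k hΦ₀m))).comp
    (MeasurableEquiv.piEquivPiSubtypeProd (fun _ : PBond (F.P p.K) k => SU N) (· ∈ (Set.toFinite (bondsIn k (s'.Ω (k + 1))ᶜ)).toFinset)).symm.measurable

/-- ★ **`hin₀` FOR ONE OLD-BRANCH PIECE FROM A FIBRE-CHART SOCKET OF THE INSIDE STEP**: given socket data `(κ, Ψ, J, S; hΨ, hJ, hpush, hfib)` for the skew averaging from the fine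
product carrier to the mixed one (`k < K` via `hk`), the step weight's graph section vanishing off `S` through the glue, the piece measurable through the glue and
`dU`-integrable — the kernel transport of the piece along the inside step IS, a.e., THE CHART's FIBRE INTEGRAL `z ↦ ∫ J(z,x)·(G_{S₀} ∘ e_β)(Ψ(z,x)) κ_z(dx)` (p610288 ★★★ with
dag-n11-e's skew measurability ∕ absolute continuity and the glue's measure preservation BY NAME). [cite: Balaban1987RG1, (0.4) p.253, §2 p.267; Balaban1988Convergent, (3.1) p.264] -/
theorem innerReading_of_oldBranch_piece_of_innerChart (ν : Stage7Numerics) (τ : TowerNumerics) (w : StepWeightsOfRecord F N ν τ.M) (p : B12.RunParams) (g : ℕ → ℝ)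
    {k : ℕ} [DecidableEq (PBond (F.P p.K) k)] [DecidableEq (PBond (F.P p.K) (k + 1))] (hk : k + 1 ≤ (F.P p.K).m + (F.P p.K).K)
    (s' : SeqOfRecord F ν τ.M g p.K (k + 1)) (W₀ : TkWeights F N V p.K)
    (Φ₀ : SFluct (F.P p.K) V → B15DeterminingSets.MSField (F.P p.K) (SU N) → ℝ) (S₀ : ℕ → Set (Site (F.P p.K) 0))
    {X : Type*} [MeasurableSpace X] (κ : Kernel ((↥(Set.toFinite (bondsIn k (s'.Ω (k + 1))ᶜ)).toFinset → SU N) × ({c : PBond (F.P p.K) (k + 1) // c ∉ (Set.toFinite (bondsIn (k + 1) (s'.Ω (k + 1))ᶜ)).toFinset} → SU N)) X) [IsSFiniteKernel κ]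
    {Ψ : ((↥(Set.toFinite (bondsIn k (s'.Ω (k + 1))ᶜ)).toFinset → SU N) × ({c : PBond (F.P p.K) (k + 1) // c ∉ (Set.toFinite (bondsIn (k + 1) (s'.Ω (k + 1))ᶜ)).toFinset} → SU N)) × X → (↥(Set.toFinite (bondsIn k (s'.Ω (k + 1))ᶜ)).toFinset → SU N) × ({b : PBond (F.P p.K) k // b ∉ (Set.toFinite (bondsIn k (s'.Ω (k + 1))ᶜ)).toFinset} → SU N)} (hΨ : Measurable Ψ)
    {J : ((↥(Set.toFinite (bondsIn k (s'.Ω (k + 1))ᶜ)).toFinset → SU N) × ({c : PBond (F.P p.K) (k + 1) // c ∉ (Set.toFinite (bondsIn (k + 1) (s'.Ω (k + 1))ᶜ)).toFinset} → SU N)) × X → ℝ≥0} (hJ : Measurable J) {S : Set ((↥(Set.toFinite (bondsIn k (s'.Ω (k + 1))ᶜ)).toFinset → SU N) × ({b : PBond (F.P p.K) k // b ∉ (Set.toFinite (bondsIn k (s'.Ω (k + 1))ᶜ)).toFinset} → SU N))}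
    (hpush : ((((Measure.pi fun _ : ↥(Set.toFinite (bondsIn k (s'.Ω (k + 1))ᶜ)).toFinset => (HaarData.haar : Measure (SU N))).prod
          (Measure.pi fun _ : {c : PBond (F.P p.K) (k + 1) // c ∉ (Set.toFinite (bondsIn (k + 1) (s'.Ω (k + 1))ᶜ)).toFinset} =>
            (HaarData.haar : Measure (SU N)))) ⊗ₘ κ).withDensity (fun z => (J z : ℝ≥0∞))).map Ψ =
      (((Measure.pi fun _ : ↥(Set.toFinite (bondsIn k (s'.Ω (k + 1))ᶜ)).toFinset => (HaarData.haar : Measure (SU N))).prod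
          (Measure.pi fun _ : {b : PBond (F.P p.K) k // b ∉ (Set.toFinite (bondsIn k (s'.Ω (k + 1))ᶜ)).toFinset} => (HaarData.haar : Measure (SU N))))).restrict S)
    (hfib : ∀ᵐ z ∂((((Measure.pi fun _ : ↥(Set.toFinite (bondsIn k (s'.Ω (k + 1))ᶜ)).toFinset => (HaarData.haar : Measure (SU N))).prod
          (Measure.pi fun _ : {c : PBond (F.P p.K) (k + 1) // c ∉ (Set.toFinite (bondsIn (k + 1) (s'.Ω (k + 1))ᶜ)).toFinset} =>
            (HaarData.haar : Measure (SU N)))) ⊗ₘ κ).withDensity (fun z => (J z : ℝ≥0∞))),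
      (fun q => (q.1, fun c : {c : PBond (F.P p.K) (k + 1) // c ∉ (Set.toFinite (bondsIn (k + 1) (s'.Ω (k + 1))ᶜ)).toFinset} =>
          (avOfRecord F N p.K k).avg
            ((MeasurableEquiv.piEquivPiSubtypeProd (fun _ : PBond (F.P p.K) k => SU N)
              (· ∈ (Set.toFinite (bondsIn k (s'.Ω (k + 1))ᶜ)).toFinset)).symm q) c)) (Ψ z) = z.1)
    (hwS : ∀ q : (↥(Set.toFinite (bondsIn k (s'.Ω (k + 1))ᶜ)).toFinset → SU N) × ({b : PBond (F.P p.K) k // b ∉ (Set.toFinite (bondsIn k (s'.Ω (k + 1))ᶜ)).toFinset} → SU N), q ∉ S →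
      w p g k s' (⇑(MeasurableEquiv.piEquivPiSubtypeProd (fun _ : PBond (F.P p.K) k => SU N)
            (· ∈ (Set.toFinite (bondsIn k (s'.Ω (k + 1))ᶜ)).toFinset)).symm q) ((avOfRecord F N p.K k).avg (⇑(MeasurableEquiv.piEquivPiSubtypeProd (fun _ : PBond (F.P p.K) k => SU N)
            (· ∈ (Set.toFinite (bondsIn k (s'.Ω (k + 1))ᶜ)).toFinset)).symm q)) = 0)
    (hGm : Measurable ((fun U => w p g k s' U ((avOfRecord F N p.K k).avg U) *
        (chiSeqOfRecord F N ν τ.M g p.K k s'.init U *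
          tkBranchOfRecord F N V ν τ.M g p.K W₀ s'.init S₀ k (fun ω => Φ₀ (S₀, fun j => (ω j).2) (fun j => (ω j).1)) (baseCfg k U))) ∘
      ⇑(MeasurableEquiv.piEquivPiSubtypeProd (fun _ : PBond (F.P p.K) k => SU N)
            (· ∈ (Set.toFinite (bondsIn k (s'.Ω (k + 1))ᶜ)).toFinset)).symm))
    (hG₀ : Integrable (fun U => w p g k s' U ((avOfRecord F N p.K k).avg U) *
        (chiSeqOfRecord F N ν τ.M g p.K k s'.init U *
          tkBranchOfRecord F N V ν τ.M g p.K W₀ s'.init S₀ k (fun ω => Φ₀ (S₀, fun j => (ω j).2) (fun j => (ω j).1)) (baseCfg k U))) (fieldMeasure (F.P p.K) k (SU N))) :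
    kernelTransport
        ((Measure.pi fun _ : ↥(Set.toFinite (bondsIn k (s'.Ω (k + 1))ᶜ)).toFinset => (HaarData.haar : Measure (SU N))).prod
          (Measure.pi fun _ : {b : PBond (F.P p.K) k // b ∉ (Set.toFinite (bondsIn k (s'.Ω (k + 1))ᶜ)).toFinset} => (HaarData.haar : Measure (SU N))))
        ((Measure.pi fun _ : ↥(Set.toFinite (bondsIn k (s'.Ω (k + 1))ᶜ)).toFinset => (HaarData.haar : Measure (SU N))).prod
          (Measure.pi fun _ : {c : PBond (F.P p.K) (k + 1) // c ∉ (Set.toFinite (bondsIn (k + 1) (s'.Ω (k + 1))ᶜ)).toFinset} =>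
            (HaarData.haar : Measure (SU N))))
        (fun q => (q.1, fun c : {c : PBond (F.P p.K) (k + 1) // c ∉ (Set.toFinite (bondsIn (k + 1) (s'.Ω (k + 1))ᶜ)).toFinset} =>
          (avOfRecord F N p.K k).avg
            ((MeasurableEquiv.piEquivPiSubtypeProd (fun _ : PBond (F.P p.K) k => SU N)
              (· ∈ (Set.toFinite (bondsIn k (s'.Ω (k + 1))ᶜ)).toFinset)).symm q) c))
        ((fun U => w p g k s' U ((avOfRecord F N p.K k).avg U) *
        (chiSeqOfRecord F N ν τ.M g p.K k s'.init U *
          tkBranchOfRecord F N V ν τ.M g p.K W₀ s'.init S₀ k (fun ω => Φ₀ (S₀, fun j => (ω j).2) (fun j => (ω j).1)) (baseCfg k U))) ∘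
          ⇑(MeasurableEquiv.piEquivPiSubtypeProd (fun _ : PBond (F.P p.K) k => SU N)
            (· ∈ (Set.toFinite (bondsIn k (s'.Ω (k + 1))ᶜ)).toFinset)).symm)
      =ᵐ[((Measure.pi fun _ : ↥(Set.toFinite (bondsIn k (s'.Ω (k + 1))ᶜ)).toFinset => (HaarData.haar : Measure (SU N))).prod
          (Measure.pi fun _ : {c : PBond (F.P p.K) (k + 1) // c ∉ (Set.toFinite (bondsIn (k + 1) (s'.Ω (k + 1))ᶜ)).toFinset} =>
            (HaarData.haar : Measure (SU N))))] fun z => ∫ x, (J (z, x) : ℝ) * ((fun U => w p g k s' U ((avOfRecord F N p.K k).avg U) *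
        (chiSeqOfRecord F N ν τ.M g p.K k s'.init U *
          tkBranchOfRecord F N V ν τ.M g p.K W₀ s'.init S₀ k (fun ω => Φ₀ (S₀, fun j => (ω j).2) (fun j => (ω j).1)) (baseCfg k U))) ∘
          ⇑(MeasurableEquiv.piEquivPiSubtypeProd (fun _ : PBond (F.P p.K) k => SU N)
            (· ∈ (Set.toFinite (bondsIn k (s'.Ω (k + 1))ᶜ)).toFinset)).symm) (Ψ (z, x)) ∂(κ z) :=
  kernelTransport_ae_eq_integral_chart_of_support
    (measurable_avOfRecord_glue_skew F N p.K k (Set.toFinite (bondsIn k (s'.Ω (k + 1))ᶜ)).toFinset (Set.toFinite (bondsIn (k + 1) (s'.Ω (k + 1))ᶜ)).toFinset)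
    (map_prod_avOfRecord_glue_skew_absolutelyContinuous_Omega (F := F) (N := N) p.K s' k hk) hΨ hJ hpush hfib hGm
    (((measurePreserving_piEquivPiSubtypeProd_symm_fieldMeasure (G := SU N) (Set.toFinite (bondsIn k (s'.Ω (k + 1))ᶜ)).toFinset).integrable_comp hG₀.aestronglyMeasurable).mpr hG₀)
    (oldBranch_piece_comp_glue_eq_zero_of_weight ν τ w p g s' W₀ Φ₀ S₀ hwS)

/-- ★★★★★★ **(O3′) ON THE NOSE FROM THE OLD-BRANCH DATA, THE INNER READINGS SUPPLIED BY A FIBRE-CHART SOCKET OF THE INSIDE STEP.**  At step `k < K`, history `s′` of length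
`k+1`, new pair `(W, Φ)`, old pair `(W₀, Φ₀)`: from (form) the level-`k` form at `init s′` (`dU`-a.e. on the `χ_k`-support), (hG₀) per-old-branch graph integrability, THE SOCKET
`(κ, Ψ, J, S; hΨ, hJ, hpush, hfib)` of the inside step, (hwS) the step weight's graph section supported in the charted set, measurability of `w`'s graph section ∕ `χ_k` ∕ `W₀.ζ` ∕
`W₀.w` ∕ the old operand at each branch, (hint) p619836's row, and (hinner₀) THE PER-OLD-BRANCH CHARTED IDENTIFICATION ON THE CHART — `slotsTOfRecord … (k+1) s′ =ᵐ[dV′]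
TkOfRecord … W (k+1) s′ Φ`.  p623644 ★★★★★★ with `Fᵢ₀ S₀ := z ↦ ∫ J(z,x)·(G_{S₀}∘e_β)(Ψ(z,x)) κ_z(dx)` (measurable by Mathlib's `StronglyMeasurable.integral_kernel_prod_right'`) and
`hin₀` from `innerReading_of_oldBranch_piece_of_innerChart`. [cite: Balaban1987RG1, (0.4) p.253, §2 p.267; Balaban1988Convergent, (2.18) p.257, (2.20)–(2.21) p.258, (3.1) p.264, (3.24)–(3.25) p.270, §3 p.279] -/
theorem slotsTOfRecord_succ_ae_eq_TkOfRecord_succ_of_oldBranchInnerChart (ν : Stage7Numerics) (τ : TowerNumerics) (E : B12.RunParams → ℝ)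
    (w : StepWeightsOfRecord F N ν τ.M) (ppSel : PpSelOfRecord F ν τ.M) (p : B12.RunParams) (g : ℕ → ℝ) {k : ℕ} (hkK : k < p.K)
    {hdec : DecidableEq (PBond (F.P p.K) k)} {hdec' : DecidableEq (PBond (F.P p.K) (k + 1))} (hk : k + 1 ≤ (F.P p.K).m + (F.P p.K).K)
    (s' : SeqOfRecord F ν τ.M g p.K (k + 1)) (W₀ W : TkWeights F N V p.K)
    (Φ₀ Φ : SFluct (F.P p.K) V → B15DeterminingSets.MSField (F.P p.K) (SU N) → ℝ)
    (hform : ∀ᵐ U ∂fieldMeasure (F.P p.K) k (SU N), chiSeqOfRecord F N ν τ.M g p.K k s'.init U ≠ 0 →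
      slotsOfRecord F N ν τ E w ppSel p g k s'.init U = TkOfRecord F N V ν τ.M g p.K W₀ k s'.init Φ₀ U)
    (hG₀ : ∀ S₀ ∈ admSOfRecord F ν τ.M g p.K k s'.init, Integrable (fun U => w p g k s' U ((avOfRecord F N p.K k).avg U) *
        (chiSeqOfRecord F N ν τ.M g p.K k s'.init U *
          tkBranchOfRecord F N V ν τ.M g p.K W₀ s'.init S₀ k (fun ω => Φ₀ (S₀, fun j => (ω j).2) (fun j => (ω j).1)) (baseCfg k U)))
      (fieldMeasure (F.P p.K) k (SU N)))
    {X : Type*} [MeasurableSpace X] (κ : Kernel ((↥(Set.toFinite (bondsIn k (s'.Ω (k + 1))ᶜ)).toFinset → SU N) × ({c : PBond (F.P p.K) (k + 1) // c ∉ (Set.toFinite (bondsIn (k + 1) (s'.Ω (k + 1))ᶜ)).toFinset} → SU N)) X) [IsSFiniteKernel κ]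
    {Ψ : ((↥(Set.toFinite (bondsIn k (s'.Ω (k + 1))ᶜ)).toFinset → SU N) × ({c : PBond (F.P p.K) (k + 1) // c ∉ (Set.toFinite (bondsIn (k + 1) (s'.Ω (k + 1))ᶜ)).toFinset} → SU N)) × X → (↥(Set.toFinite (bondsIn k (s'.Ω (k + 1))ᶜ)).toFinset → SU N) × ({b : PBond (F.P p.K) k // b ∉ (Set.toFinite (bondsIn k (s'.Ω (k + 1))ᶜ)).toFinset} → SU N)} (hΨ : Measurable Ψ)
    {J : ((↥(Set.toFinite (bondsIn k (s'.Ω (k + 1))ᶜ)).toFinset → SU N) × ({c : PBond (F.P p.K) (k + 1) // c ∉ (Set.toFinite (bondsIn (k + 1) (s'.Ω (k + 1))ᶜ)).toFinset} → SU N)) × X → ℝ≥0} (hJ : Measurable J) {S : Set ((↥(Set.toFinite (bondsIn k (s'.Ω (k + 1))ᶜ)).toFinset → SU N) × ({b : PBond (F.P p.K) k // b ∉ (Set.toFinite (bondsIn k (s'.Ω (k + 1))ᶜ)).toFinset} → SU N))}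
    (hpush : ((((Measure.pi fun _ : ↥(Set.toFinite (bondsIn k (s'.Ω (k + 1))ᶜ)).toFinset => (HaarData.haar : Measure (SU N))).prod
          (Measure.pi fun _ : {c : PBond (F.P p.K) (k + 1) // c ∉ (Set.toFinite (bondsIn (k + 1) (s'.Ω (k + 1))ᶜ)).toFinset} =>
            (HaarData.haar : Measure (SU N)))) ⊗ₘ κ).withDensity (fun z => (J z : ℝ≥0∞))).map Ψ =
      (((Measure.pi fun _ : ↥(Set.toFinite (bondsIn k (s'.Ω (k + 1))ᶜ)).toFinset => (HaarData.haar : Measure (SU N))).prod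
          (Measure.pi fun _ : {b : PBond (F.P p.K) k // b ∉ (Set.toFinite (bondsIn k (s'.Ω (k + 1))ᶜ)).toFinset} => (HaarData.haar : Measure (SU N))))).restrict S)
    (hfib : ∀ᵐ z ∂((((Measure.pi fun _ : ↥(Set.toFinite (bondsIn k (s'.Ω (k + 1))ᶜ)).toFinset => (HaarData.haar : Measure (SU N))).prod
          (Measure.pi fun _ : {c : PBond (F.P p.K) (k + 1) // c ∉ (Set.toFinite (bondsIn (k + 1) (s'.Ω (k + 1))ᶜ)).toFinset} =>
            (HaarData.haar : Measure (SU N)))) ⊗ₘ κ).withDensity (fun z => (J z : ℝ≥0∞))),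
      (fun q => (q.1, fun c : {c : PBond (F.P p.K) (k + 1) // c ∉ (Set.toFinite (bondsIn (k + 1) (s'.Ω (k + 1))ᶜ)).toFinset} =>
          (avOfRecord F N p.K k).avg
            ((MeasurableEquiv.piEquivPiSubtypeProd (fun _ : PBond (F.P p.K) k => SU N)
              (· ∈ (Set.toFinite (bondsIn k (s'.Ω (k + 1))ᶜ)).toFinset)).symm q) c)) (Ψ z) = z.1)
    (hwS : ∀ q : (↥(Set.toFinite (bondsIn k (s'.Ω (k + 1))ᶜ)).toFinset → SU N) × ({b : PBond (F.P p.K) k // b ∉ (Set.toFinite (bondsIn k (s'.Ω (k + 1))ᶜ)).toFinset} → SU N), q ∉ S →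
      w p g k s' (⇑(MeasurableEquiv.piEquivPiSubtypeProd (fun _ : PBond (F.P p.K) k => SU N)
            (· ∈ (Set.toFinite (bondsIn k (s'.Ω (k + 1))ᶜ)).toFinset)).symm q) ((avOfRecord F N p.K k).avg (⇑(MeasurableEquiv.piEquivPiSubtypeProd (fun _ : PBond (F.P p.K) k => SU N)
            (· ∈ (Set.toFinite (bondsIn k (s'.Ω (k + 1))ᶜ)).toFinset)).symm q)) = 0)
    (hwm : Measurable fun U => w p g k s' U ((avOfRecord F N p.K k).avg U)) (hχm : Measurable (chiSeqOfRecord F N ν τ.M g p.K k s'.init))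
    (hζm : ∀ j Y, Measurable (W₀.ζ j Y)) (hwWm : ∀ j Λ' Y S, Measurable (W₀.w j Λ' Y S))
    (hΦ₀m : ∀ S₀ ∈ admSOfRecord F ν τ.M g p.K k s'.init,
      Measurable fun ω : MultiCfg (F.P p.K) (SU N) V => Φ₀ (S₀, fun j => (ω j).2) (fun j => (ω j).1))
    (hint : ∀ᵐ q ∂((Measure.pi fun _ : ↥(Set.toFinite (bondsIn (k + 1) (s'.Ω (k + 1))ᶜ)).toFinset => (HaarData.haar : Measure (SU N))).prod
          (Measure.pi fun _ : {c : PBond (F.P p.K) (k + 1) // c ∉ (Set.toFinite (bondsIn (k + 1) (s'.Ω (k + 1))ᶜ)).toFinset} =>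
            (HaarData.haar : Measure (SU N)))),
      ∀ S ∈ admSOfRecord F ν τ.M g p.K (k + 1) s', Integrable
        (fun y : ↥(Set.toFinite (bondsIn k (s'.Ω (k + 1))ᶜ)).toFinset → SU N =>
          zetaOp (genDataOfRecord F N V ν τ.M g p.K W s' S k).ζ
            (aOp k (genDataOfRecord F N V ν τ.M g p.K W s' S k).sA (genDataOfRecord F N V ν τ.M g p.K W s' S k).w
              (tkBranchOfRecord F N V ν τ.M g p.K W s' S k (fun ω => Φ (S, fun j => (ω j).2) (fun j => (ω j).1))))
            (Function.update (baseCfg (k + 1) ((MeasurableEquiv.piEquivPiSubtypeProd (fun _ : PBond (F.P p.K) (k + 1) => SU N)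
                (· ∈ (Set.toFinite (bondsIn (k + 1) (s'.Ω (k + 1))ᶜ)).toFinset)).symm q)) k
              (Function.updateFinset ((baseCfg (V := V) (k + 1) ((MeasurableEquiv.piEquivPiSubtypeProd (fun _ : PBond (F.P p.K) (k + 1) => SU N)
                (· ∈ (Set.toFinite (bondsIn (k + 1) (s'.Ω (k + 1))ᶜ)).toFinset)).symm q)) k).1 (Set.toFinite (bondsIn k (s'.Ω (k + 1))ᶜ)).toFinset y,
                ((baseCfg (V := V) (k + 1) ((MeasurableEquiv.piEquivPiSubtypeProd (fun _ : PBond (F.P p.K) (k + 1) => SU N)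
                (· ∈ (Set.toFinite (bondsIn (k + 1) (s'.Ω (k + 1))ᶜ)).toFinset)).symm q)) k).2)))
        (condLaw (Measure.pi fun _ : ↥(Set.toFinite (bondsIn k (s'.Ω (k + 1))ᶜ)).toFinset => (HaarData.haar : Measure (SU N)))
          (avgRestrOfRecord F N p.K k (Set.toFinite (bondsIn k (s'.Ω (k + 1))ᶜ)).toFinset (Set.toFinite (bondsIn (k + 1) (s'.Ω (k + 1))ᶜ)).toFinset) q.1))
    (hinner₀ : ∀ᵐ q ∂((Measure.pi fun _ : ↥(Set.toFinite (bondsIn (k + 1) (s'.Ω (k + 1))ᶜ)).toFinset => (HaarData.haar : Measure (SU N))).prod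
          (Measure.pi fun _ : {c : PBond (F.P p.K) (k + 1) // c ∉ (Set.toFinite (bondsIn (k + 1) (s'.Ω (k + 1))ᶜ)).toFinset} =>
            (HaarData.haar : Measure (SU N)))),
      ∀ S₀ ∈ admSOfRecord F ν τ.M g p.K k s'.init, ∀ y : ↥(Set.toFinite (bondsIn k (s'.Ω (k + 1))ᶜ)).toFinset → SU N,
        avgRestrOfRecord F N p.K k (Set.toFinite (bondsIn k (s'.Ω (k + 1))ᶜ)).toFinset (Set.toFinite (bondsIn (k + 1) (s'.Ω (k + 1))ᶜ)).toFinset y = q.1 →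
        (∫ x, (J ((y, q.2), x) : ℝ) * ((fun U => w p g k s' U ((avOfRecord F N p.K k).avg U) *
        (chiSeqOfRecord F N ν τ.M g p.K k s'.init U *
          tkBranchOfRecord F N V ν τ.M g p.K W₀ s'.init S₀ k (fun ω => Φ₀ (S₀, fun j => (ω j).2) (fun j => (ω j).1)) (baseCfg k U))) ∘
          ⇑(MeasurableEquiv.piEquivPiSubtypeProd (fun _ : PBond (F.P p.K) k => SU N)
            (· ∈ (Set.toFinite (bondsIn k (s'.Ω (k + 1))ᶜ)).toFinset)).symm) (Ψ ((y, q.2), x)) ∂(κ (y, q.2))) =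
          ∑ Y ∈ (Set.toFinite {Y : Set (Site (F.P p.K) 0) | Y ∈ SClassOfRecord F ν g p.K (k + 1) ∧ Y ⊆ s'.Ω (k + 1) ∩ (s'.Λ (k + 1))ᶜ}).toFinset,
            zetaOp (genDataOfRecord F N V ν τ.M g p.K W s' (Function.update S₀ (k + 1) Y) k).ζ
              (aOp k (genDataOfRecord F N V ν τ.M g p.K W s' (Function.update S₀ (k + 1) Y) k).sA
                (genDataOfRecord F N V ν τ.M g p.K W s' (Function.update S₀ (k + 1) Y) k).w
                (tkBranchOfRecord F N V ν τ.M g p.K W s'.init S₀ k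
                  (fun ω => Φ (Function.update S₀ (k + 1) Y, fun j => (ω j).2) (fun j => (ω j).1))))
              (Function.update (baseCfg (k + 1) ((MeasurableEquiv.piEquivPiSubtypeProd (fun _ : PBond (F.P p.K) (k + 1) => SU N)
                (· ∈ (Set.toFinite (bondsIn (k + 1) (s'.Ω (k + 1))ᶜ)).toFinset)).symm q)) k
              (Function.updateFinset ((baseCfg (V := V) (k + 1) ((MeasurableEquiv.piEquivPiSubtypeProd (fun _ : PBond (F.P p.K) (k + 1) => SU N)
                (· ∈ (Set.toFinite (bondsIn (k + 1) (s'.Ω (k + 1))ᶜ)).toFinset)).symm q)) k).1 (Set.toFinite (bondsIn k (s'.Ω (k + 1))ᶜ)).toFinset y,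
                ((baseCfg (V := V) (k + 1) ((MeasurableEquiv.piEquivPiSubtypeProd (fun _ : PBond (F.P p.K) (k + 1) => SU N)
                (· ∈ (Set.toFinite (bondsIn (k + 1) (s'.Ω (k + 1))ᶜ)).toFinset)).symm q)) k).2))) :
    slotsTOfRecord F N ν τ E w ppSel p g (k + 1) s' =ᵐ[fieldMeasure (F.P p.K) (k + 1) (SU N)] TkOfRecord F N V ν τ.M g p.K W (k + 1) s' Φ := by
  have hGm : ∀ S₀ ∈ admSOfRecord F ν τ.M g p.K k s'.init, Measurable ((fun U => w p g k s' U ((avOfRecord F N p.K k).avg U) *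
        (chiSeqOfRecord F N ν τ.M g p.K k s'.init U *
          tkBranchOfRecord F N V ν τ.M g p.K W₀ s'.init S₀ k (fun ω => Φ₀ (S₀, fun j => (ω j).2) (fun j => (ω j).1)) (baseCfg k U))) ∘
      ⇑(MeasurableEquiv.piEquivPiSubtypeProd (fun _ : PBond (F.P p.K) k => SU N)
            (· ∈ (Set.toFinite (bondsIn k (s'.Ω (k + 1))ᶜ)).toFinset)).symm) := fun S₀ h₀ =>
    measurable_oldBranch_piece_comp_glue ν τ w p g s' W₀ Φ₀ S₀ hwm hχm hζm hwWm (hΦ₀m S₀ h₀)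
  refine slotsTOfRecord_succ_ae_eq_TkOfRecord_succ_of_oldBranchInnerSum ν τ E w ppSel p g hkK (hdec := hdec) (hdec' := hdec') hk s' W₀ W Φ₀ Φ
    hform hG₀ (fun S₀ z => ∫ x, (J (z, x) : ℝ) * ((fun U => w p g k s' U ((avOfRecord F N p.K k).avg U) *
        (chiSeqOfRecord F N ν τ.M g p.K k s'.init U *
          tkBranchOfRecord F N V ν τ.M g p.K W₀ s'.init S₀ k (fun ω => Φ₀ (S₀, fun j => (ω j).2) (fun j => (ω j).1)) (baseCfg k U))) ∘
          ⇑(MeasurableEquiv.piEquivPiSubtypeProd (fun _ : PBond (F.P p.K) k => SU N)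
            (· ∈ (Set.toFinite (bondsIn k (s'.Ω (k + 1))ᶜ)).toFinset)).symm) (Ψ (z, x)) ∂(κ z)) (fun S₀ h₀ => ?_) (fun S₀ h₀ => ?_) hint ?_
  · -- measurability of the chart's fibre integral of the piece
    exact ((measurable_coe_nnreal_real.comp hJ).mul ((hGm S₀ h₀).comp hΨ)).stronglyMeasurable.integral_kernel_prod_right'.measurable
  · exact innerReading_of_oldBranch_piece_of_innerChart ν τ w p g hk s' W₀ Φ₀ S₀ κ hΨ hJ hpush hfib hwS (hGm S₀ h₀) (hG₀ S₀ h₀)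
  · filter_upwards [hinner₀] with q hq S₀ h₀ y hy
    exact hq S₀ h₀ y hy

end Summit.QuantumFields.YangMills.Theorems.BalabanUVNodesN11TStepOldBranchInnerChart

end
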